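/-
Copyright (c) 2026 the pub-hodgecm-mathlib formalisation cell (harness21).  Prover seat hodgecm-mathlib-LH4-p13 (g9), req620 Track A «(D-RAM) FOUR-FRAME» squad
((β₂) road (R-36); β₂ sub-dealer LH4-p04 (g9) β₂-BOARD v2 row (OFF-top) «top-diagonal cone cells», dealt by name 22:47:07Z; helper lane on h413 =
stmt-HodgeConjecture-24833, count-neutral), 2026-09-04.
-/
import Summits.HodgeConjecture.HodgeConjecture.Theorems.F0P3cDyRamShellLineModel   -- ★ p861579 (LH4-p16 (g0)): `latticeInLevel_endoGL_sub_one_sq_iff_isOrd` (the square token of a glued vertex in the line model); brings ★ DEFS `IsOrd`, ★ census DEFS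
import HarnessLib

/-!
# Crux `H413`, line LH4 «(D-RAM) FOUR-FRAME» — the (β₂) road (R-36), β₂-BOARD v2 row (OFF-top): «ABOVE THE ROW THE SQUARE TOKEN FAILS» — on a cone cell `(j, b)` whose
# depth letters satisfy `jl + m < j + b + k` (on the top diagonal `j + m = jl + b`: `2(m − b) < M`) EVERY glued vertex has `(Γ − 1)²·L ⊄ ϖ^M·L`, so it lies on NO `(ℓ, M)`
# near-transvection shell (any `q`, any `d`, any `ℓ`)

Cell `hodgecm-mathlib` (D-0151), FLOOR 0, crux item H413 = `stmt-HodgeConjecture-24833`, route of record `HCCMUnconditional`; squad F0∕P3c∕LH4; lane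
`--supports stmt-HodgeConjecture-24833 --as helper` (count-neutral; pays NO tier-0 row).  THEOREMS ONLY (no `def`, no instance, no notation, no `sorry`, default heartbeats);
★-only imports; states NO law; (β₂) stays a HYPOTHESIS.  DATUM-FREE: plane field `E` with `|ϖ| = exp(−1)`, line model `(M, jE, ρ, α)` (`ρ` isometric, `ρα ≠ α`, `ρ` fixes
`jE(E)`), a glued vertex `L` with tube `b` over `Λ = φ(B₂) = x₀·𝒪_cc`, `φ w₀ = Y⁻¹x₀` (★ `…ShellLineModel` letters VERBATIM), `cc = ϖE^j`.  NO residue field, NO `|2|`, NO `σ`.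

WHY (β₂ sub-dealer LH4-p04 (g9) β₂-BOARD v2 (00b5a5b7) §1 row (OFF-top); sibling of ★ p862651 `…DeepConeCellOffShell` (LH7-p09 (g2), the (OFF-mid) cells BELOW the row, where the
LEVEL digit is the one that moves)).  The (β₂) cone ledger `beta2ConesB.letter.v2` sums `cellDiff(j, b)` over the cone cells; its ED. 2 cut «OFF-ROW ZERO + ROW `2b = m`» needs, above
the row (`m < 2b`), that a cell contributes `0`.  On the DIAGONAL above the row (`j + m = jl + b`, the only populated top cells by ★ (R1-OFF)∕(R1-TOP)) the depth quotient `z₀ = μ∕Y`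
(`μ = lam − jE u₀₀`, `|μ| = |ϖE|^m`, `|μ − ρμ| = |ϖE|^{jl}·|α − ρα|`, `|Y| = |ϖE|^b`) lies in `𝒪_cc` (the cell's depth clause), and the THIRD clause of the square token of ★
`…ShellLineModel.latticeInLevel_endoGL_sub_one_sq_iff_isOrd` asks `w := ((lam − 1)² − (jE u₀₀ − 1)²)∕(ϖE^M·Y) = z₀·ν∕ϖE^M ∈ 𝒪_cc`, `ν := (lam − 1) + (jE u₀₀ − 1)` (so `ν − ρν =
μ − ρμ`).  Now `w − ρw = ((z₀ − ρz₀)·ν + ρz₀·(ν − ρν))∕ϖE^M`; the second term has size EXACTLY `|ϖE|^{m − b + jl − M}·|α − ρα|`, the first at most `|ϖE|^{j}·|α − ρα|` once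
`|ν| ≤ |ϖE|^M`; so when `jl + m < j + b + k` the second term is STRICTLY larger than the order's bound `|cc(α − ρα)| = |ϖE|^j·|α − ρα|` and than the first term — `w ∉ 𝒪_cc`, the
square token FAILS, and the vertex is on no `(ℓ, M)`-shell for any `ℓ`.  On the top diagonal this is `2(m − b) < M`: with `M = m* ≤ m_c` BOTH labels `q₊` (shell `(ℓ₀, m*)`) and `q₋′`
(shell `(ℓ₀, m_c)`) of ★ p861305 §3 are false on every vertex of the cells `b > m − m*∕2`, which pay `0`; the strip `m∕2 < b ≤ m − M∕2` (non-empty once `m > M`) is NOT touched by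
this file (there the square token can hold: it is the «UPPER LINE» of LH7-p09 (g2)'s census, labelled and balanced in the engine tables — the ε-exchange road, other hand).
* §1 `v_pow_eq_exp_neg'` (bookkeeping), `not_isOrd_mul_div_of_top` — THE DIGIT: `¬ IsOrd ρ α (ϖE^j) (μ·ν ∕ (ϖE^M·Y))` from the five size letters and `jl + m < j + b + k`.
* §2 HEADS `not_latticeInLevel_sq_endoGL_sub_one_of_top` (`¬ LatticeInLevel ϖ k ((Γ − 1)·(Γ − 1)) L`) and `not_latticeNearTransvShell_of_top` (`∀ ℓ, ¬ LatticeNearTransvShell ϖ ℓ k (Γ − 1) L`),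
  in ★ `…ShellLineModel`'s glued-vertex letters + the cell's `hYb`, the depth clause `hz : IsOrd cc (μ∕Y)`, the key letters `hμ hjl`, `hν : |ν| ≤ |ϖE|^M`, and `htop : jl + m < j + b + k`.
WHAT IS NOT CLAIMED.  Which top cells are populated (★ (R1-TOP), LH7-p10 (g2)'s atlas); the strip `2(m − b) ≥ M`; `|ν| ≤ |ϖE|^M` is taken as a letter (the consumer reads it off
`M ≤ m` and `|2·(u₀₀ − 1)| ≤ |ϖ|^M`, e.g. `M = m_c = m* + d − 1` from `hum` and `d ≤ t + 1`); any census law.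
HONEST LABEL.  Count-neutral valuation algebra; nothing printed is asserted; `HC_CM` is proved only modulo the 7 printed citations (2 remaining named inputs: hLiu418 =
`stmt-HodgeConjecture-24832`, h413 = `stmt-HodgeConjecture-24833`) until rung 0 closes.
## References
* [Serre1979] J.-P. Serre, *Local Fields*, GTM 67 (1979): Ch. III §6 Prop. 12 (orders of conductor `c`).
* [Kottwitz1986BaseChangeUnits] R. E. Kottwitz, *Base change for unit elements of Hecke algebras*, Compositio Math. 60 (1986): §1 pp. 240–241 (congruence-level pieces as lattice conditions).
* [Jacobowitz1962] R. Jacobowitz, *Hermitian forms over local fields*, Amer. J. Math. 84 (1962): §4 (duals, gluing).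
* [Rogawski1990] J. D. Rogawski, *Automorphic Representations of Unitary Groups in Three Variables*, Ann. of Math. Stud. 123 (1990): §4.9 Prop. 4.9.1 (b) p. 55.
-/

set_option autoImplicit false

noncomputable section

namespace Summit.HodgeConjecture.HodgeConjecture.Cruxes.H413.F0P3cDyRamTopConeCellOffShell

open scoped Valued WithZero Matrix MatrixGroups
open WithZero
open Literature.NumberTheory.Automorphic Literature.NumberTheory.Automorphic.HermitianLattice Literature.NumberTheory.Automorphic.UnitaryLatticeTree
open Literature.NumberTheory.Rogawski1990
open Summit.HodgeConjecture.HodgeConjecture.Cruxes.H413.F0P3cDyRamToricCensusDefs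
open Summit.HodgeConjecture.HodgeConjecture.Cruxes.H413.F0P3cDyRamFourFrameCensusDefs (LatticeInLevel LatticeNearTransvShell)
open Summit.HodgeConjecture.HodgeConjecture.Cruxes.H413.F0P3cDyRamShellLineModel (latticeInLevel_endoGL_sub_one_sq_iff_isOrd)

variable {E M : Type} [Field E] [Valued E ℤᵐ⁰] [Field M] [Valued M ℤᵐ⁰] {ρ : M →+* M} {α : M}

/-! ## §1 The digit: above the row the third clause of the square token fails -/

/-- Bookkeeping: `|P| = exp(−1) ⇒ |P|^n = exp(−n)`. [cite: Serre1979, Ch. III §6 Prop. 12] -/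
theorem v_pow_eq_exp_neg' {P : M} (hP : Valued.v P = exp (-1 : ℤ)) (n : ℕ) : Valued.v P ^ n = exp (-(n : ℤ)) := by
  rw [hP, ← exp_nsmul, nsmul_eq_mul, mul_neg, mul_one]

/-- **THE DIGIT — «ABOVE THE ROW THE SQUARE TOKEN FAILS» (any `q`, any `d`).**  Line model: `ρ` isometric, `ρα ≠ α`, `ρP = P`, `|P| = exp(−1)` (`P = ϖE`).  SIZE LETTERS:
`|Y| = |P|^b` (the cell's level), `|μ| = |P|^m`, `|μ − ρμ| = |P|^{jl}·|α − ρα|` (the key's depths), the DEPTH CLAUSE `|μ∕Y − ρ(μ∕Y)| ≤ |P^j·(α − ρα)|` of the cone cell `(j, b)`,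
and an element `ν` with `ν − ρν = μ − ρμ`, `|ν| ≤ |P|^M`.  IF `jl + m < j + b + k` THEN `μ·ν∕(P^M·Y) ∉ 𝒪_{P^j}`: in
`μν∕(P^M Y) − ρ(μν∕(P^M Y)) = ((μ∕Y − ρ(μ∕Y))·ν + ρ(μ∕Y)·(ν − ρν))∕P^M` the second summand has size `exp(−(m − b + jl − M))·|α − ρα| > exp(−j)·|α − ρα|` and dominates the first.
[cite: Serre1979, Ch. III §6 Prop. 12] [cite: Kottwitz1986BaseChangeUnits, §1 pp. 240–241] -/
theorem not_isOrd_mul_div_of_top (hvρ : ∀ x, Valued.v (ρ x) = Valued.v x) (hα : ρ α ≠ α)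
    {P : M} (hρP : ρ P = P) (hP : Valued.v P = exp (-1 : ℤ))
    {Y μ ν : M} {j b m jl k : ℕ}
    (hYb : Valued.v Y = Valued.v P ^ b) (hμ : Valued.v μ = Valued.v P ^ m) (hjl : Valued.v (μ - ρ μ) = Valued.v P ^ jl * Valued.v (α - ρ α))
    (hz : Valued.v (μ / Y - ρ (μ / Y)) ≤ Valued.v (P ^ j * (α - ρ α)))
    (hνρ : ν - ρ ν = μ - ρ μ) (hν : Valued.v ν ≤ Valued.v P ^ k) (htop : jl + m < j + b + k) :
    ¬ IsOrd ρ α (P ^ j) (μ * ν / (P ^ k * Y)) := by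
  intro hO
  have h2 := ((isOrd_iff _ _ _ _).1 hO).2
  -- non-vanishing bookkeeping
  have hvP0 : Valued.v P ≠ 0 := by rw [hP]; exact exp_ne_zero
  have hP0 : P ≠ 0 := fun h0 => hvP0 (by rw [h0, map_zero])
  have hPk0 : P ^ k ≠ 0 := pow_ne_zero k hP0
  have hY0 : Y ≠ 0 := fun h0 => by
    rw [h0, map_zero] at hYb
    exact pow_ne_zero b hvP0 hYb.symm
  have hρY0 : ρ Y ≠ 0 := (map_ne_zero ρ).2 hY0
  have hα0 : α - ρ α ≠ 0 := sub_ne_zero.2 (Ne.symm hα)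
  have hvα0 : Valued.v (α - ρ α) ≠ 0 := (Valuation.ne_zero_iff _).2 hα0
  -- every size as `exp` of an integer
  set κ : ℤ := log (Valued.v (α - ρ α)) with hκ
  have hc : Valued.v (α - ρ α) = exp κ := by rw [hκ, exp_log hvα0]
  have hPn : ∀ n : ℕ, Valued.v P ^ n = exp (-(n : ℤ)) := v_pow_eq_exp_neg' hP
  -- the identity
  have e : μ * ν / (P ^ k * Y) - ρ (μ * ν / (P ^ k * Y)) = ((μ / Y - ρ (μ / Y)) * ν + ρ (μ / Y) * (ν - ρ ν)) / P ^ k := by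
    rw [map_div₀, map_mul, map_mul, map_pow, hρP, map_div₀]
    field_simp
    ring
  -- sizes of the two summands
  have hT2 : Valued.v (ρ (μ / Y) * (ν - ρ ν)) = exp (-(m : ℤ) + b + (-(jl : ℤ) + κ)) := by
    rw [map_mul, hvρ, map_div₀, hμ, hYb, hνρ, hjl, hPn, hPn, hPn, hc, ← exp_sub, ← exp_add, ← exp_add]
    congr 1; ring
  have hT1 : Valued.v ((μ / Y - ρ (μ / Y)) * ν) ≤ exp (-(j : ℤ) + κ + (-(k : ℤ))) := by
    rw [map_mul, exp_add]
    refine mul_le_mul' ?_ (hν.trans_eq (hPn k))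
    calc Valued.v (μ / Y - ρ (μ / Y)) ≤ Valued.v (P ^ j * (α - ρ α)) := hz
      _ = exp (-(j : ℤ) + κ) := by rw [map_mul, map_pow, hPn, hc, ← exp_add]
  have hlt : Valued.v ((μ / Y - ρ (μ / Y)) * ν) < Valued.v (ρ (μ / Y) * (ν - ρ ν)) := by
    rw [hT2]
    refine lt_of_le_of_lt hT1 ?_
    rw [exp_lt_exp]; omega
  have hsum : Valued.v ((μ / Y - ρ (μ / Y)) * ν + ρ (μ / Y) * (ν - ρ ν)) = exp (-(m : ℤ) + b + (-(jl : ℤ) + κ)) := by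
    rw [add_comm, Valuation.map_add_eq_of_lt_left _ hlt, hT2]
  -- the order's bound is violated
  rw [e, map_div₀, hsum, map_pow, hPn, ← exp_sub, map_mul, map_pow, hPn, hc, ← exp_add, exp_le_exp] at h2
  omega

/-! ## §2 HEADS — every glued vertex over such a cell fails the square token, hence is on no `(ℓ, M)` shell -/

/-- **HEAD — «ABOVE THE ROW THE SQUARE TOKEN FAILS», LATTICE FORM (any `q`, any `d`).**  Frame: ★ `…ShellLineModel.latticeInLevel_endoGL_sub_one_sq_iff_isOrd`'s glued-vertex letters
VERBATIM (plane `E`, `|ϖ| = exp(−1)`, line model `(M, jE, ρ, α; φ, lam)` with `Fix ρ ⊇ jE(E)` (`hjfix`) and `jE` isometric (`hjiso`), vertex `L` with tube `b` over `(B₂, w₀, g₀)`,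
`Λ = φ(B₂) = x₀·𝒪_cc` with `cc = jE ϖ^j`, `φ w₀ = Y⁻¹x₀`); the CELL's level `hYb : |Y| = |jE ϖ|^b` and DEPTH CLAUSE `hz : IsOrd (jE ϖ^j) (μ∕Y)` (`μ := lam − jE u₀₀`; ★ DEFS
`forall_dual_mul_mem_iff` reading of `levelSetDep`); the KEY letters `hm : |μ| = |jE ϖ|^m`, `hjl : |μ − ρμ| = |jE ϖ|^{jl}·|α − ρα|`; the smallness `hν : |(lam − 1) + (jE u₀₀ − 1)| ≤ |jE ϖ|^M`;
and `htop : jl + m < j + b + k`.  THEN `¬ LatticeInLevel ϖ k ((Γ − 1)·(Γ − 1)) L`, `Γ = endoGL (γ₂, u)` — the square token at level `M` FAILS (its third clause is §1's digit, since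
`(lam − 1)² − (jE u₀₀ − 1)² = μ·ν`). [cite: Kottwitz1986BaseChangeUnits, §1 pp. 240–241] [cite: Serre1979, Ch. III §6 Prop. 12] [cite: Jacobowitz1962, §4] -/
theorem not_latticeInLevel_sq_endoGL_sub_one_of_top
    (hvρ : ∀ x, Valued.v (ρ x) = Valued.v x) (hα : ρ α ≠ α)
    {ϖ : E} (hϖ : Valued.v ϖ = exp (-1 : ℤ))
    (jE : E →+* M) (hjiso : ∀ a, Valued.v (jE a) = Valued.v a) (hjfix : ∀ z, ρ z = z ↔ ∃ c, jE c = z)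
    (φ : (Fin 2 → E) →+ M) (hφs : ∀ (c : E) (x : Fin 2 → E), φ (c • x) = jE c * φ x) (hφi : Function.Injective φ)
    {γ₂ : GL (Fin 2) E} {lam : M} (hφγ : ∀ x, φ ((γ₂ : Matrix (Fin 2) (Fin 2) E) *ᵥ x) = lam * φ x)
    {L : Submodule 𝒪[E] (Fin 3 → E)} {b : ℕ} (hb : ∀ a : E, (Pi.single 1 a : Fin 3 → E) ∈ L ↔ Valued.v a ≤ Valued.v ϖ ^ b)
    (hpr : ∀ x ∈ L, Valued.v (x 1) * Valued.v ϖ ^ b ≤ 1)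
    {B₂ : Submodule 𝒪[E] (Fin 2 → E)} {w₀ : Fin 2 → E} {g₀ : Fin 3 → E}
    (hB : B₂.map ((Matrix.toLin' (!![1, 0; 0, 0; 0, 1] : Matrix (Fin 3) (Fin 2) E)).restrictScalars 𝒪[E]) =
      L ⊓ LinearMap.ker ((LinearMap.proj (1 : Fin 3) : (Fin 3 → E) →ₗ[E] E).restrictScalars 𝒪[E]))
    (hg₀ : g₀ ∈ L) (hg₀1 : Valued.v (g₀ 1) * Valued.v ϖ ^ b = 1) (hprg : g₀ - Pi.single 1 (g₀ 1) = ![w₀ 0, 0, w₀ 1])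
    {Λ : AddSubgroup M} (hBΛ : B₂.toAddSubgroup.map φ = Λ) {x₀ Y : M} (hx₀ : x₀ ≠ 0) {j : ℕ}
    (hΛx : ∀ x, x ∈ Λ ↔ ∃ z, IsOrd ρ α (jE ϖ ^ j) z ∧ x = x₀ * z) (hw₀Y : φ w₀ = Y⁻¹ * x₀)
    (hYb : Valued.v Y = Valued.v (jE ϖ) ^ b)
    (u : GL (Fin 1) E) {m jl k : ℕ}
    (hm : Valued.v (lam - jE ((u : Matrix (Fin 1) (Fin 1) E) 0 0)) = Valued.v (jE ϖ) ^ m)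
    (hjl : Valued.v ((lam - jE ((u : Matrix (Fin 1) (Fin 1) E) 0 0)) - ρ (lam - jE ((u : Matrix (Fin 1) (Fin 1) E) 0 0))) = Valued.v (jE ϖ) ^ jl * Valued.v (α - ρ α))
    (hz : IsOrd ρ α (jE ϖ ^ j) ((lam - jE ((u : Matrix (Fin 1) (Fin 1) E) 0 0)) / Y))
    (hν : Valued.v ((lam - 1) + (jE ((u : Matrix (Fin 1) (Fin 1) E) 0 0) - 1)) ≤ Valued.v (jE ϖ) ^ k)
    (htop : jl + m < j + b + k) :
    ¬ LatticeInLevel ϖ k (((((endoGL (γ₂, u) : GL (Fin 3) E) : Matrix (Fin 3) (Fin 3) E) - 1)) * ((((endoGL (γ₂, u) : GL (Fin 3) E) : Matrix (Fin 3) (Fin 3) E) - 1))) L := by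
  have hvϖ0 : Valued.v ϖ ≠ 0 := by rw [hϖ]; exact exp_ne_zero
  have hjϖ : Valued.v (jE ϖ) = exp (-1 : ℤ) := by rw [hjiso, hϖ]
  have hvjϖ0 : Valued.v (jE ϖ) ≠ 0 := by rw [hjϖ]; exact exp_ne_zero
  have hY0 : Y ≠ 0 := fun h0 => by
    rw [h0, map_zero] at hYb
    exact pow_ne_zero b hvjϖ0 hYb.symm
  have hρϖ : ρ (jE ϖ) = jE ϖ := (hjfix _).2 ⟨ϖ, rfl⟩
  have hρu : ρ (jE ((u : Matrix (Fin 1) (Fin 1) E) 0 0)) = jE ((u : Matrix (Fin 1) (Fin 1) E) 0 0) := (hjfix _).2 ⟨_, rfl⟩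
  -- the third clause of the square token is §1's digit
  set μ : M := lam - jE ((u : Matrix (Fin 1) (Fin 1) E) 0 0) with hμdef
  set ν : M := (lam - 1) + (jE ((u : Matrix (Fin 1) (Fin 1) E) 0 0) - 1) with hνdef
  have hfac : (lam - 1) ^ 2 - (jE ((u : Matrix (Fin 1) (Fin 1) E) 0 0) - 1) ^ 2 = μ * ν := by rw [hμdef, hνdef]; ring
  have hνρ : ν - ρ ν = μ - ρ μ := by
    simp only [hνdef, hμdef, map_add, map_sub, map_one, hρu]
    ring
  have hdigit := not_isOrd_mul_div_of_top hvρ hα hρϖ hjϖ hYb hm hjl ((isOrd_iff _ _ _ _).1 hz).2 hνρ hν htop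
  intro hsq
  rw [latticeInLevel_endoGL_sub_one_sq_iff_isOrd hvρ hϖ jE φ hφs hφi hφγ hb hpr hB hg₀ hg₀1 hprg hBΛ hx₀ hY0 hΛx hw₀Y u k, hfac] at hsq
  exact hdigit hsq.2.2

/-- **HEAD — «ABOVE THE ROW EVERY VERTEX IS OFF THE `(ℓ, M)` SHELL» (any `q`, any `d`, any `ℓ`).**  Same letters: `¬ LatticeNearTransvShell ϖ ℓ k (Γ − 1) L` for EVERY level `ℓ` (the
shell's square clause is the token that fails).  In the (β₂) cell currency of ★ p861305 §3 (`q₊` = shell `(ℓ₀, m*)` ∧ `VS = V₊`, `q₋′` = shell `(ℓ₀, m_c)` ∧ `¬ VS = V₊`, `m* ≤ m_c`): on the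
top-diagonal cells with `2(m − b) < m*` BOTH labels are false on every glued vertex (apply at `M = m*` and `M = m_c`), so the cell pays `0` to the labelled difference (★ p861332
`natCast_finsum_sub_eq_zero_of_forall_not`). [cite: Kottwitz1986BaseChangeUnits, §1 pp. 240–241] [cite: Rogawski1990, §4.9 Prop. 4.9.1 (b) p. 55] [cite: Serre1979, Ch. III §6 Prop. 12] -/
theorem not_latticeNearTransvShell_of_top
    (hvρ : ∀ x, Valued.v (ρ x) = Valued.v x) (hα : ρ α ≠ α)
    {ϖ : E} (hϖ : Valued.v ϖ = exp (-1 : ℤ))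
    (jE : E →+* M) (hjiso : ∀ a, Valued.v (jE a) = Valued.v a) (hjfix : ∀ z, ρ z = z ↔ ∃ c, jE c = z)
    (φ : (Fin 2 → E) →+ M) (hφs : ∀ (c : E) (x : Fin 2 → E), φ (c • x) = jE c * φ x) (hφi : Function.Injective φ)
    {γ₂ : GL (Fin 2) E} {lam : M} (hφγ : ∀ x, φ ((γ₂ : Matrix (Fin 2) (Fin 2) E) *ᵥ x) = lam * φ x)
    {L : Submodule 𝒪[E] (Fin 3 → E)} {b : ℕ} (hb : ∀ a : E, (Pi.single 1 a : Fin 3 → E) ∈ L ↔ Valued.v a ≤ Valued.v ϖ ^ b)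
    (hpr : ∀ x ∈ L, Valued.v (x 1) * Valued.v ϖ ^ b ≤ 1)
    {B₂ : Submodule 𝒪[E] (Fin 2 → E)} {w₀ : Fin 2 → E} {g₀ : Fin 3 → E}
    (hB : B₂.map ((Matrix.toLin' (!![1, 0; 0, 0; 0, 1] : Matrix (Fin 3) (Fin 2) E)).restrictScalars 𝒪[E]) =
      L ⊓ LinearMap.ker ((LinearMap.proj (1 : Fin 3) : (Fin 3 → E) →ₗ[E] E).restrictScalars 𝒪[E]))
    (hg₀ : g₀ ∈ L) (hg₀1 : Valued.v (g₀ 1) * Valued.v ϖ ^ b = 1) (hprg : g₀ - Pi.single 1 (g₀ 1) = ![w₀ 0, 0, w₀ 1])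
    {Λ : AddSubgroup M} (hBΛ : B₂.toAddSubgroup.map φ = Λ) {x₀ Y : M} (hx₀ : x₀ ≠ 0) {j : ℕ}
    (hΛx : ∀ x, x ∈ Λ ↔ ∃ z, IsOrd ρ α (jE ϖ ^ j) z ∧ x = x₀ * z) (hw₀Y : φ w₀ = Y⁻¹ * x₀)
    (hYb : Valued.v Y = Valued.v (jE ϖ) ^ b)
    (u : GL (Fin 1) E) {m jl k : ℕ}
    (hm : Valued.v (lam - jE ((u : Matrix (Fin 1) (Fin 1) E) 0 0)) = Valued.v (jE ϖ) ^ m)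
    (hjl : Valued.v ((lam - jE ((u : Matrix (Fin 1) (Fin 1) E) 0 0)) - ρ (lam - jE ((u : Matrix (Fin 1) (Fin 1) E) 0 0))) = Valued.v (jE ϖ) ^ jl * Valued.v (α - ρ α))
    (hz : IsOrd ρ α (jE ϖ ^ j) ((lam - jE ((u : Matrix (Fin 1) (Fin 1) E) 0 0)) / Y))
    (hν : Valued.v ((lam - 1) + (jE ((u : Matrix (Fin 1) (Fin 1) E) 0 0) - 1)) ≤ Valued.v (jE ϖ) ^ k)
    (htop : jl + m < j + b + k) (ℓ : ℕ) :
    ¬ LatticeNearTransvShell ϖ ℓ k ((((endoGL (γ₂, u) : GL (Fin 3) E) : Matrix (Fin 3) (Fin 3) E) - 1)) L := fun h =>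
  not_latticeInLevel_sq_endoGL_sub_one_of_top hvρ hα hϖ jE hjiso hjfix φ hφs hφi hφγ hb hpr hB hg₀ hg₀1 hprg hBΛ hx₀ hΛx hw₀Y hYb u hm hjl hz hν htop h.2.2

end Summit.HodgeConjecture.HodgeConjecture.Cruxes.H413.F0P3cDyRamTopConeCellOffShell

end
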